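import Summits.QuantumFields.YangMills.Theorems.TwistedTraceScaling.Negative.CoreTransferRecordDefect
import HarnessLib

/-!
# R54D (crux `TwistedTraceScaling`, stmt-QuantumFields-20203): the CORE DEFECT OF RECORD (`…BOCoreDefectRecord.core_defect_record`, lane A, 2026-08-29T08:12Z) delivers the
# CONSTANT rate `2η` on the slow window `powScale (1/3) β` — neither is what `BOBricks` consumes

Standing disprover `ym-cdisprove-20203-1` (gen 43), sequel of R54C (`…Negative.CoreTransferRecordDefect`, imported).  `core_defect_record : ∃ c₁, ∀ η > 0, ∀ᶠ β, … |∫ φ·I − c₁M·∫ φρ̃| ≤ 2η·(c₁M·∫ |φ|ρ̃)` for amplitudes `φ`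
supported in `{‖q(u_k) − 1‖ ≤ powScale (1/3) β ∧ L³S(u) ≤ powScale (1/3) β}` ("step (C4)-core with the explicit rate `2η`, `η ↓ 0`").  TRUE as stated.  Priced against `BOBricks`:
* `constant_rate_not_hb_small` / `coreDefectRecord_rate_not_hb_small`: a defect rate bounded below by a positive constant (here `b = 2η`) never satisfies `hb_small`
  (`∀ a > 0, ∀ᶠ β, b² ≤ a·λ_b(L³β)`), because `λ_b(L³β) → 0`; the `∀ η > 0, ∀ᶠ β` shape yields no rate in `β` (and the explicit one behind it is `≍ ℓ⁴β^{-1/6}` at `q = 1/3`, R53R/R54C);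
* `core_not_subset_recordSupport`: the support window of `core_defect_record` does not contain the `hcore` core `{orbitDist < 13(L³β)^{-1/5}}` eventually (R54B) — so it cannot be
  applied to the amplitudes `φ` that `BOBricks.hcore`/`hOD_of_defect` quantify over (`φ u ≠ 0 → orbitDist u < δ₁ β` with the core radius).
(`λ_b(L³β) → 0` is `R54C.tendsto_bareLambda_cube`.)
Repairs (theirs, stated before): quasimode WITH RATE; `σ = powScale q β`, `q > 1/3`; input window `δu = 13(L³β)^{-1/5}` (or the core itself).
HONEST FRAMING: stub of a child of the CONDITIONAL reduction route R2b1; nothing here refutes `core_defect_record` or `TwistedTraceScaling`; (C4), (C5), (B-ST), C4-CORE remain OPEN;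
not infinite volume, not a mass gap, not Clay.
-/

set_option autoImplicit false

noncomputable section

open Real Filter Topology
open Literature.MathematicalPhysics.QuantumFieldTheory
open Literature.MathematicalPhysics.QuantumLattice
open Summit.QuantumFields.YangMills.Theorems.FemtoTransferGap
open Summit.QuantumFields.YangMills.Theorems.FemtoTransferGap.TwoLattice
open Summit.QuantumFields.YangMills.Theorems.TwistedTraceScaling.Negative

namespace Summit.QuantumFields.YangMills.Theorems.TwistedTraceScaling.Negative.R54D

variable {L : ℕ} [NeZero L]

/-- ★ **A rate bounded below by a positive constant never meets `hb_small`.** [folklore] -/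
theorem constant_rate_not_hb_small {b : ℝ → ℝ} {η : ℝ} (hη : 0 < η) (hfloor : ∀ᶠ β : ℝ in atTop, η ≤ b β) :
    ¬ ∀ a : ℝ, 0 < a → ∀ᶠ β : ℝ in atTop, b β ^ 2 ≤ a * bareLambda ((L : ℝ) ^ 3 * β) := by
  intro H
  have hsmall : ∀ᶠ β : ℝ in atTop, bareLambda ((L : ℝ) ^ 3 * β) < η ^ 2 :=
    (R54C.tendsto_bareLambda_cube (L := L)).eventually (eventually_lt_nhds (by positivity))
  obtain ⟨β, hb, hfl, hsm⟩ := ((H 1 one_pos).and (hfloor.and hsmall)).exists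
  nlinarith [mul_self_le_mul_self hη.le hfl]

/-- ★★ **THE RECORD's EXPLICIT RATE `2η` (η > 0 constant, `…BOCoreDefectRecord.core_defect_record`) FAILS `hb_small`** — as `BOBricks.b` it would need `(2η)² ≤ a·λ_b(L³β)`
for every `a > 0` eventually, impossible since `λ_b(L³β) → 0`. [folklore] -/
theorem coreDefectRecord_rate_not_hb_small {η : ℝ} (hη : 0 < η) :
    ¬ ∀ a : ℝ, 0 < a → ∀ᶠ β : ℝ in atTop, (2 * η) ^ 2 ≤ a * bareLambda ((L : ℝ) ^ 3 * β) :=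
  constant_rate_not_hb_small (L := L) (b := fun _ => 2 * η) (by positivity) (Eventually.of_forall fun _ => le_rfl)

/-- ★★ **THE SUPPORT WINDOW OF `core_defect_record` DOES NOT CONTAIN THE `hcore` CORE**: eventually in `β` it is false that every `u` with `orbitDist u < 13(L³β)^{-1/5}` lies in
`{∀ k, ‖q(u_k) − 1‖ ≤ powScale (1/3) β ∧ L³·S(u) ≤ powScale (1/3) β}` (the quaternion clause already fails: R54B `record_inputWindow_not_core`). [folklore] -/
theorem core_not_subset_recordSupport :
    ∀ᶠ β : ℝ in atTop, ¬ ∀ u : GaugeConfig 3 1 FemtoTransferGap.SU2, orbitDist u < 13 * (((L : ℝ)) ^ 3 * β) ^ (-(1 / 5 : ℝ)) →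
      (∀ k : Fin 3, ‖su2Quat (u (0, k)) - 1‖ ≤ powScale (1 / 3) β) ∧ (L : ℝ) ^ 3 * wilsonAction su2Rep u ≤ powScale (1 / 3) β := by
  filter_upwards [R54B.record_inputWindow_not_core (L := L)] with β h H
  obtain ⟨u, hu, k, hk⟩ := h
  exact absurd ((H u hu).1 k) (not_le.mpr hk)

/-- Numbers: `(2η)² = 4η²`; the three record exponents `1/3, 1/3, 1/3` vs the box `s > 1/6` ✓, `p ≤ 1/5` ✗, `q > 1/3` ✗. -/
example (η : ℝ) : (2 * η) ^ 2 = 4 * η ^ 2 ∧ (1 : ℝ) / 6 < 1 / 3 ∧ ¬ ((1 : ℝ) / 3 ≤ 1 / 5) ∧ ¬ ((1 : ℝ) / 3 < 1 / 3) := by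
  refine ⟨by ring, by norm_num, by norm_num, by norm_num⟩

end Summit.QuantumFields.YangMills.Theorems.TwistedTraceScaling.Negative.R54D

end
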